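import Summits.AtomisticToContinuum.Crystallization.Theses.SpectralChargeLedger
import Summits.AtomisticToContinuum.Crystallization.Theorems.ChargedEnergyGap.Negative.BlocksLocal
import Summits.AtomisticToContinuum.Crystallization.Theorems.ChargedEnergyGap.Negative.BlocksBound
import Summits.AtomisticToContinuum.Crystallization.Theorems.PhononSlackCertificatesCoerciveTwoShellGapBlocks

/-!
# Crux `SummedShellPricing` (stmt-AtomisticToContinuum-17044, K1 of route `SpectralChargeLedger`),
# line `Sketch`: registered sub-goal `stub_blocksConverse` — finite `1/3`-separated K1 ⇒ torus K1

The finite form of K1 for `1/3`-separated configurations (one cell `(a₀, h₀)` in the box and, for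
every `τ ∈ (0,1]`, a price `κ > 0` with `κ·#B ≤ E_LJ(y) − N·e⋆` for every set `B` of τ-bad sites)
implies its TORUS form with the same cell and the same `κ(τ)`:
`κ·#{q ∈ motif : q τ-bad in P.points} ≤ #motif·(e(P) − e⋆)` for every periodic `P` with
`1/3`-separated point set.  Trial blocks; port of
`Theorems/PhononSlackCertificatesCoerciveTwoShellGapBlocks.lean` (`torusTwoShellGap_of_sepTwoShellGap`)
to K1's set-based first-shell predicate, on the landed block infrastructure
`ChargedEnergyGap.Negative.Blocks*`:
* K1's τ-goodness of a centre `q` in a point set `S` depends on `S` only through the open punctured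
  shell `{z ∈ S | z ≠ q, dist z q < 13/10·a₀}`; it is invariant under the periods of `P`
  (`good_of_good_add`, via `matched_translate`), and at a `depth P 2`-deep block point of
  `x_K = Blocks.blockConfig P K` the shell read in `Set.range x_K` EQUALS the shell read in
  `P.points` (`shell_block_eq`, `Blocks.exists_eq_toP_of_dist_lt`, as `13/10·a₀ ≤ 13/10 < 2`), so a
  deep block index is τ-good in `x_K` only if its motif class is τ-good in `P.points`
  (`good_transfer`); hence `#bad(x_K) ≥ #bad motif · (K³ − 6·depth·K²)` (`le_card_bad_block`);
* feed `B := bad(x_K)` to the hypothesis (`x_K` is `1/3`-separated,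
  `CoerciveTwoShellGapBlocks.block_separated`), use
  `E_LJ(x_K) ≤ #motif·K³·(e(P) + ε)` for `K ≥ K₀(ε)` (`Blocks.exists_block_energy_le`), divide by
  `K³`, let `K → ∞`, `ε → 0` (`torus_bound_of_blocks`).
The counting and the limit are proved with the goodness predicates as opaque variables
(`le_card_bad_block`, `block_ineq`, `torus_of_blocks`) and instantiated at the end.
-/

noncomputable section

namespace Summit.AtomisticToContinuum.Crystallization.Theorems.SummedShellPricingBlocks

open scoped BigOperators Classical
open Literature.MathematicalPhysics.StatisticalMechanics Literature.Geometry.DiscreteGeometry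
open Summit.AtomisticToContinuum.Crystallization.Theorems.ChargedEnergyGapNegative

variable (P : PeriodicConfiguration 3) (K : ℕ)

/-! ## Abstract counting and limit (goodness predicates as variables) -/

/-- **Counting** (abstract form of `CoerciveTwoShellGapBlocks.card_bad_block_ge`): if every
`d`-deep block index that is good in the block has a good motif class, then the block has at least
`#bad motif · (K³ − 6·d·K²)` bad indices — every pair (bad motif point, deep coordinate triple)
gives a distinct bad block index, and at most `6·d·K²` coordinate triples are not deep
(`Blocks.card_not_deep_le`). [folklore] -/
theorem le_card_bad_block {d : ℕ} {GoodS : E3 → Prop}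
    {GoodB : Fin (Fintype.card (Blocks.BIdx P K)) → Prop}
    (htransfer : ∀ a, Blocks.IsDeep K d ((Fintype.equivFin (Blocks.BIdx P K)).symm a).2 →
      GoodB a → GoodS ((((Fintype.equivFin (Blocks.BIdx P K)).symm a).1 : E3)))
    {BadM : Finset E3} (hsub : BadM ⊆ P.motif) (hbad : ∀ q ∈ BadM, ¬ GoodS q)
    {BadB : Finset (Fin (Fintype.card (Blocks.BIdx P K)))} (hBadB : ∀ i, ¬ GoodB i → i ∈ BadB) :
    (BadM.card : ℝ) * ((K : ℝ) ^ 3 - 6 * (d : ℝ) * (K : ℝ) ^ 2) ≤ (BadB.card : ℝ) := by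
  -- adapted from Theorems/PhononSlackCertificatesCoerciveTwoShellGapBlocks.lean (card_bad_block_ge)
  set e := Fintype.equivFin (Blocks.BIdx P K) with he
  set Deep : Finset (Fin 3 → Fin K) := Finset.univ.filter fun k => Blocks.IsDeep K d k with hDeep
  -- (1) the injection (bad motif point, deep coordinates) ↦ block index
  have hinj : (BadM.attach ×ˢ Deep).card ≤ BadB.card := by
    refine Finset.card_le_card_of_injOn (fun p => e (⟨p.1.1, hsub p.1.2⟩, p.2)) (fun p hp => ?_) ?_
    · have hp' := Finset.mem_product.1 hp
      have hk : Blocks.IsDeep K d p.2 := (Finset.mem_filter.1 hp'.2).2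
      rw [Finset.mem_coe]
      refine hBadB _ fun hgood => hbad p.1.1 p.1.2 ?_
      have hsymm : e.symm (e (⟨p.1.1, hsub p.1.2⟩, p.2)) = (⟨p.1.1, hsub p.1.2⟩, p.2) :=
        e.symm_apply_apply _
      have key := htransfer (e (⟨p.1.1, hsub p.1.2⟩, p.2)) (by rw [hsymm]; exact hk) hgood
      rw [hsymm] at key
      exact key
    · intro p _ q _ hpq
      obtain ⟨h1, h2⟩ := Prod.mk.inj (e.injective hpq)
      have h11 : p.1.1 = q.1.1 := by simpa using congrArg Subtype.val h1
      exact Prod.ext (Subtype.ext h11) h2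
  -- (2) the number of deep coordinate triples
  have hDeepCard : (K : ℝ) ^ 3 - 6 * (d : ℝ) * (K : ℝ) ^ 2 ≤ (Deep.card : ℝ) := by
    have hsplit := Finset.card_filter_add_card_filter_not
      (s := (Finset.univ : Finset (Fin 3 → Fin K))) (fun k => Blocks.IsDeep K d k)
    have huniv : (Finset.univ : Finset (Fin 3 → Fin K)).card = K ^ 3 := by
      rw [Finset.card_univ, Fintype.card_fun, Fintype.card_fin, Fintype.card_fin]
    have hnot : (Finset.univ.filter fun k : Fin 3 → Fin K => ¬ Blocks.IsDeep K d k).card ≤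
        6 * d * K ^ 2 := by
      convert Blocks.card_not_deep_le K d
    rw [huniv] at hsplit
    have h1 : (Deep.card : ℝ) +
        ((Finset.univ.filter fun k : Fin 3 → Fin K => ¬ Blocks.IsDeep K d k).card : ℝ) =
          (K : ℝ) ^ 3 := by
      rw [hDeep]; exact_mod_cast hsplit
    have h2 : ((Finset.univ.filter fun k : Fin 3 → Fin K => ¬ Blocks.IsDeep K d k).card : ℝ) ≤
        6 * (d : ℝ) * (K : ℝ) ^ 2 := by exact_mod_cast hnot
    linarith
  -- (3) assemble
  have hprod : ((BadM.attach ×ˢ Deep).card : ℝ) = (BadM.card : ℝ) * (Deep.card : ℝ) := by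
    rw [Finset.card_product, Finset.card_attach, Nat.cast_mul]
  have hD0 : (0 : ℝ) ≤ (BadM.card : ℝ) := Nat.cast_nonneg _
  have hinj' : (BadM.card : ℝ) * (Deep.card : ℝ) ≤ (BadB.card : ℝ) := by
    rw [← hprod]; exact_mod_cast hinj
  exact (mul_le_mul_of_nonneg_left hDeepCard hD0).trans hinj'

/-- **One block** (abstract): the pricing hypothesis on the block `x_K`, applied to the set of its
bad indices, and the counting `le_card_bad_block` give
`κ · #bad motif · (K³ − 6 d K²) ≤ E_LJ(x_K) − #block · e⋆`. [folklore] -/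
theorem block_ineq {κ : ℝ} (hκ : 0 ≤ κ) {d : ℕ} {GoodS : E3 → Prop}
    {GoodB : Fin (Fintype.card (Blocks.BIdx P K)) → Prop}
    (htransfer : ∀ a, Blocks.IsDeep K d ((Fintype.equivFin (Blocks.BIdx P K)).symm a).2 →
      GoodB a → GoodS ((((Fintype.equivFin (Blocks.BIdx P K)).symm a).1 : E3)))
    {BadM : Finset E3} (hsub : BadM ⊆ P.motif) (hbad : ∀ q ∈ BadM, ¬ GoodS q)
    (hKB : ∀ B : Finset (Fin (Fintype.card (Blocks.BIdx P K))), (∀ i ∈ B, ¬ GoodB i) →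
      κ * (B.card : ℝ) ≤ interactionEnergy lennardJones (Blocks.blockConfig P K) -
        (Fintype.card (Blocks.BIdx P K) : ℝ) *
          (⨅ Q : PeriodicConfiguration 3, Q.energyPerParticle lennardJones)) :
    κ * ((BadM.card : ℝ) * ((K : ℝ) ^ 3 - 6 * (d : ℝ) * (K : ℝ) ^ 2)) ≤
      interactionEnergy lennardJones (Blocks.blockConfig P K) -
        (Fintype.card (Blocks.BIdx P K) : ℝ) *
          (⨅ Q : PeriodicConfiguration 3, Q.energyPerParticle lennardJones) := by
  set B : Finset (Fin (Fintype.card (Blocks.BIdx P K))) := Finset.univ.filter fun i => ¬ GoodB i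
    with hB
  have h1 := hKB B fun i hi => (Finset.mem_filter.1 hi).2
  have h2 := le_card_bad_block P K htransfer hsub hbad (BadB := B)
    fun i hi => Finset.mem_filter.2 ⟨Finset.mem_univ _, hi⟩
  exact (mul_le_mul_of_nonneg_left h2 hκ).trans h1

/-- **The limit** (abstract form of `CoerciveTwoShellGapBlocks.torusTwoShellGap_of_sepTwoShellGap`):
if every block `x_K` satisfies `κ · D · (K³ − 6 d K²) ≤ E_LJ(x_K) − #motif·K³·e⋆`, then
`κ · D ≤ #motif · (e(P) − e⋆)`: use `E_LJ(x_K) ≤ #motif·K³·(e(P) + ε)` for `K ≥ K₀(ε)`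
(`Blocks.exists_block_energy_le`), divide by `K³`, let `K → ∞` and `ε → 0`. [folklore] -/
theorem torus_bound_of_blocks {κ D : ℝ} (d : ℕ)
    (hblock : ∀ K : ℕ, κ * (D * ((K : ℝ) ^ 3 - 6 * (d : ℝ) * (K : ℝ) ^ 2)) ≤
      interactionEnergy lennardJones (Blocks.blockConfig P K) -
        (Fintype.card (Blocks.BIdx P K) : ℝ) *
          (⨅ Q : PeriodicConfiguration 3, Q.energyPerParticle lennardJones)) :
    κ * D ≤ (P.motif.card : ℝ) * (P.energyPerParticle lennardJones -
      (⨅ Q : PeriodicConfiguration 3, Q.energyPerParticle lennardJones)) := by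
  -- adapted from …/PhononSlackCertificatesCoerciveTwoShellGapBlocks.lean (torusTwoShellGap_of_sep…)
  set eS : ℝ := (⨅ Q : PeriodicConfiguration 3, Q.energyPerParticle lennardJones) with heS
  set m : ℝ := (P.motif.card : ℝ) with hmdef
  have hm : 0 < m := by rw [hmdef]; exact_mod_cast P.motif_nonempty.card_pos
  set d' : ℝ := (d : ℝ) with hddef
  refine le_of_forall_pos_lt_add fun ε hε => ?_
  -- block energy for `K ≥ K₀`, and `K` large enough for the error term
  obtain ⟨K₀, hK₀, hK⟩ := Blocks.exists_block_energy_le P (show (0 : ℝ) < ε / (4 * m) by positivity)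
  obtain ⟨K₁, hK₁⟩ := exists_nat_gt (4 * (6 * d' * κ * D) / ε)
  obtain ⟨Kn, hKn0, hKn1⟩ : ∃ Kn : ℕ, K₀ ≤ Kn ∧ K₁ ≤ Kn := ⟨max K₀ K₁, le_max_left _ _, le_max_right _ _⟩
  have hKpos : 0 < Kn := lt_of_lt_of_le hK₀ hKn0
  set k : ℝ := (Kn : ℝ) with hkdef
  have hk : 0 < k := by rw [hkdef]; exact_mod_cast hKpos
  have hk1 : 4 * (6 * d' * κ * D) / ε < k := hK₁.trans_le (by rw [hkdef]; exact_mod_cast hKn1)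
  -- the two inequalities on the block `x_Kn`
  have hlow := hblock Kn
  have hup := hK Kn hKn0
  have hN : ((Fintype.card (Blocks.BIdx P Kn) : ℕ) : ℝ) = m * k ^ 3 := by
    rw [Blocks.card_BIdx]; push_cast; rw [hmdef, hkdef]
  rw [hN] at hup hlow
  -- combine: κ D (k³ − 6 d k²) ≤ m k³ (e P + ε/(4m)) − m k³ eS
  have hcomb : κ * (D * (k ^ 3 - 6 * d' * k ^ 2)) ≤
      m * k ^ 3 * (P.energyPerParticle lennardJones + ε / (4 * m)) - m * k ^ 3 * eS :=
    hlow.trans (by linarith)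
  have h4 : m * k ^ 3 * (ε / (4 * m)) = k ^ 3 * (ε / 4) := by field_simp
  have herr : 6 * d' * κ * D < k * (ε / 4) := by
    have := (div_lt_iff₀ hε).1 hk1
    linarith
  have hk2 : 0 < k ^ 2 := by positivity
  have hmain : k * (κ * D) ≤ k * (m * (P.energyPerParticle lennardJones - eS) + ε / 4) +
      6 * d' * κ * D := by
    have : k ^ 2 * (k * (κ * D)) ≤
        k ^ 2 * (k * (m * (P.energyPerParticle lennardJones - eS) + ε / 4) + 6 * d' * κ * D) := by
      nlinarith
    exact le_of_mul_le_mul_left this hk2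
  have hmain2 : k * (κ * D) < k * (m * (P.energyPerParticle lennardJones - eS) + ε / 2) := by
    nlinarith
  have hmain3 : κ * D < m * (P.energyPerParticle lennardJones - eS) + ε / 2 :=
    lt_of_mul_lt_mul_left hmain2 hk.le
  linarith

/-- **Finite pricing on the blocks ⇒ torus pricing** (abstract in the goodness predicates): if
deep good block indices have good motif classes (`htransfer`) and every block `x_K` is priced
(`hKB`), then `κ · #bad motif ≤ #motif · (e(P) − e⋆)`. [folklore] -/
theorem torus_of_blocks {κ : ℝ} (hκ : 0 < κ) {d : ℕ} {GoodS : E3 → Prop}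
    {GoodB : ∀ K : ℕ, Fin (Fintype.card (Blocks.BIdx P K)) → Prop}
    (htransfer : ∀ (K : ℕ) (a : Fin (Fintype.card (Blocks.BIdx P K))),
      Blocks.IsDeep K d ((Fintype.equivFin (Blocks.BIdx P K)).symm a).2 →
        GoodB K a → GoodS ((((Fintype.equivFin (Blocks.BIdx P K)).symm a).1 : E3)))
    (hKB : ∀ (K : ℕ) (B : Finset (Fin (Fintype.card (Blocks.BIdx P K)))),
      (∀ i ∈ B, ¬ GoodB K i) →
        κ * (B.card : ℝ) ≤ interactionEnergy lennardJones (Blocks.blockConfig P K) -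
          (Fintype.card (Blocks.BIdx P K) : ℝ) *
            (⨅ Q : PeriodicConfiguration 3, Q.energyPerParticle lennardJones)) :
    κ * ((P.motif.filter fun q => ¬ GoodS q).card : ℝ) ≤
      (P.motif.card : ℝ) * (P.energyPerParticle lennardJones -
        (⨅ Q : PeriodicConfiguration 3, Q.energyPerParticle lennardJones)) :=
  torus_bound_of_blocks P d fun K =>
    block_ineq P K hκ.le (htransfer K) (Finset.filter_subset _ _)
      (fun _ hq => (Finset.mem_filter.1 hq).2) (hKB K)

/-! ## The first-shell predicate: lattice invariance and transfer at deep block points -/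

/-- **Translating a shell matching**: if `T₂ + g = T₁` (pointwise) and `q₂ + g = q₁`, a
bijection `e : T₁ ≃ R` with `dist (t − q₁) (f (e t)) ≤ τ` yields one for `T₂` and `q₂`
(compose with the translation `T₂ ≃ T₁`, `t ↦ t + g`). [folklore] -/
theorem matched_translate {T₁ T₂ R : Set E3} {q₁ q₂ g : E3} {τ : ℝ} (f : E3 → E3)
    (hT : ∀ z, z ∈ T₂ ↔ z + g ∈ T₁) (hq : q₂ + g = q₁) :
    (∃ e : T₁ ≃ R, ∀ t : T₁, dist ((t : E3) - q₁) (f ((e t : R) : E3)) ≤ τ) →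
      ∃ e : T₂ ≃ R, ∀ t : T₂, dist ((t : E3) - q₂) (f ((e t : R) : E3)) ≤ τ := by
  rintro ⟨e, he⟩
  let tr : T₂ ≃ T₁ :=
    { toFun := fun t => ⟨(t : E3) + g, (hT t).1 t.2⟩
      invFun := fun t => ⟨(t : E3) - g, (hT _).2 (by simp)⟩
      left_inv := fun t => Subtype.ext (by simp)
      right_inv := fun t => Subtype.ext (by simp) }
  refine ⟨tr.trans e, fun t => ?_⟩
  have h1 := he (tr t)
  have h2 : ((tr t : T₁) : E3) - q₁ = (t : E3) - q₂ := by
    rw [← hq]; show (t : E3) + g - (q₂ + g) = _; abel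
  rw [h2] at h1
  exact h1

/-- **Lattice invariance of first-shell goodness in `P.points`**: for a period `g` of `P`, if the
centre `q + g` is τ-good then so is `q` — the shell of `q + g` is the `g`-translate of the shell
of `q` (`PeriodicConfiguration.add_mem_points`) and `(z + g) − (q + g) = z − q`, so the same
isometry and the translated bijection work (`matched_translate`). [folklore] -/
theorem good_of_good_add {a₀ h₀ τ : ℝ} {q g : E3} (hg : g ∈ P.lattice) :
    (∃ A : E3 →ₗᵢ[ℝ] E3,
      (∃ e : ↥{z : E3 | z ∈ P.points ∧ z ≠ q + g ∧ dist z (q + g) < 13 / 10 * a₀} ≃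
          ↥{p : E3 | p ∈ hcpStacking a₀ h₀ ∧ p ≠ 0 ∧ ‖p‖ < 13 / 10 * a₀},
        ∀ t : ↥{z : E3 | z ∈ P.points ∧ z ≠ q + g ∧ dist z (q + g) < 13 / 10 * a₀},
          dist ((t : E3) - (q + g))
            (A ((e t : ↥{p : E3 | p ∈ hcpStacking a₀ h₀ ∧ p ≠ 0 ∧ ‖p‖ < 13 / 10 * a₀}) : E3)) ≤ τ) ∨
      (∃ e : ↥{z : E3 | z ∈ P.points ∧ z ≠ q + g ∧ dist z (q + g) < 13 / 10 * a₀} ≃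
          ↥{p : E3 | p ∈ fccStacking a₀ h₀ ∧ p ≠ 0 ∧ ‖p‖ < 13 / 10 * a₀},
        ∀ t : ↥{z : E3 | z ∈ P.points ∧ z ≠ q + g ∧ dist z (q + g) < 13 / 10 * a₀},
          dist ((t : E3) - (q + g))
            (A ((e t : ↥{p : E3 | p ∈ fccStacking a₀ h₀ ∧ p ≠ 0 ∧ ‖p‖ < 13 / 10 * a₀}) : E3)) ≤ τ)) →
    ∃ A : E3 →ₗᵢ[ℝ] E3,
      (∃ e : ↥{z : E3 | z ∈ P.points ∧ z ≠ q ∧ dist z (q) < 13 / 10 * a₀} ≃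
          ↥{p : E3 | p ∈ hcpStacking a₀ h₀ ∧ p ≠ 0 ∧ ‖p‖ < 13 / 10 * a₀},
        ∀ t : ↥{z : E3 | z ∈ P.points ∧ z ≠ q ∧ dist z (q) < 13 / 10 * a₀},
          dist ((t : E3) - q)
            (A ((e t : ↥{p : E3 | p ∈ hcpStacking a₀ h₀ ∧ p ≠ 0 ∧ ‖p‖ < 13 / 10 * a₀}) : E3)) ≤ τ) ∨
      (∃ e : ↥{z : E3 | z ∈ P.points ∧ z ≠ q ∧ dist z (q) < 13 / 10 * a₀} ≃
          ↥{p : E3 | p ∈ fccStacking a₀ h₀ ∧ p ≠ 0 ∧ ‖p‖ < 13 / 10 * a₀},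
        ∀ t : ↥{z : E3 | z ∈ P.points ∧ z ≠ q ∧ dist z (q) < 13 / 10 * a₀},
          dist ((t : E3) - q)
            (A ((e t : ↥{p : E3 | p ∈ fccStacking a₀ h₀ ∧ p ≠ 0 ∧ ‖p‖ < 13 / 10 * a₀}) : E3)) ≤ τ) := by
  -- adapted from Theorems/PhononSlackCertificatesCoerciveTwoShellGapBlocks.lean
  -- (isTwoShellGoodSet_add_iff), for the set-based first-shell predicate
  have hT : ∀ z : E3, z ∈ {z : E3 | z ∈ P.points ∧ z ≠ q ∧ dist z (q) < 13 / 10 * a₀} ↔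
      z + g ∈ {z : E3 | z ∈ P.points ∧ z ≠ q + g ∧ dist z (q + g) < 13 / 10 * a₀} := by
    intro z
    simp only [Set.mem_setOf_eq, dist_add_right, ne_eq, add_left_inj]
    refine and_congr_left fun _ => ⟨fun h => P.add_mem_points h hg, fun h => ?_⟩
    simpa using P.add_mem_points h (P.lattice.neg_mem hg)
  rintro ⟨A, h | h⟩
  · exact ⟨A, Or.inl (matched_translate A hT rfl h)⟩
  · exact ⟨A, Or.inr (matched_translate A hT rfl h)⟩

/-- **The shell of a deep block point is read inside the block**: at a block point of
`x_K = Blocks.blockConfig P K` whose lattice coordinates are `depth P ρ`-deep, the open punctured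
`r`-shell (`r ≤ ρ`) in `Set.range x_K` equals the one in `P.points` — block points are points of
`P` (`Blocks.bpt_mem`), and a point of `P` within `< ρ` of a deep block point is a block point
(`Blocks.exists_eq_toP_of_dist_lt`). [folklore] -/
theorem shell_block_eq {ρ r : ℝ} (hr : r ≤ ρ) {a : Fin (Fintype.card (Blocks.BIdx P K))}
    (hdeep : Blocks.IsDeep K (Blocks.depth P ρ) ((Fintype.equivFin (Blocks.BIdx P K)).symm a).2) :
    {z : E3 | z ∈ Set.range (Blocks.blockConfig P K) ∧ z ≠ Blocks.blockConfig P K a ∧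
        dist z (Blocks.blockConfig P K a) < r} =
      {z : E3 | z ∈ P.points ∧ z ≠ Blocks.blockConfig P K a ∧
        dist z (Blocks.blockConfig P K a) < r} := by
  ext z
  simp only [Set.mem_setOf_eq]
  constructor
  · rintro ⟨⟨j, rfl⟩, hne, hd⟩
    exact ⟨Blocks.bpt_mem P K _, hne, hd⟩
  · rintro ⟨hz, hne, hd⟩
    refine ⟨?_, hne, hd⟩
    have hne' : (⟨z, hz⟩ : P.points) ≠
        Blocks.toP P K ((Fintype.equivFin (Blocks.BIdx P K)).symm a) := by
      intro h
      apply hne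
      have := congrArg Subtype.val h
      simpa [Blocks.blockConfig_apply] using this
    have hlt : dist (Blocks.bpt P K ((Fintype.equivFin (Blocks.BIdx P K)).symm a)) z < ρ := by
      rw [dist_comm]; exact lt_of_lt_of_le hd hr
    obtain ⟨v, -, hv⟩ := Blocks.exists_eq_toP_of_dist_lt P K hdeep ⟨z, hz⟩ hne' hlt
    refine ⟨Fintype.equivFin (Blocks.BIdx P K) v, ?_⟩
    rw [Blocks.blockConfig_apply, Equiv.symm_apply_apply]
    exact congrArg Subtype.val hv

/-- **Goodness transfer at deep block points**: a `depth P 2`-deep block index that is τ-good in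
the finite block `x_K` has a τ-good motif class in `P.points` (`a₀ ≤ 1`, so the shell radius is
`13/10·a₀ ≤ 13/10 < 2`): rewrite the shell along `shell_block_eq`, then use lattice invariance
`good_of_good_add` (`x_K a = motif point + period`). [folklore] -/
theorem good_transfer {a₀ h₀ τ : ℝ} (ha : a₀ ≤ 1) {a : Fin (Fintype.card (Blocks.BIdx P K))}
    (hdeep : Blocks.IsDeep K (Blocks.depth P 2) ((Fintype.equivFin (Blocks.BIdx P K)).symm a).2) :
    (∃ A : E3 →ₗᵢ[ℝ] E3,
      (∃ e : ↥{z : E3 | z ∈ Set.range (Blocks.blockConfig P K) ∧ z ≠ Blocks.blockConfig P K a ∧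
            dist z (Blocks.blockConfig P K a) < 13 / 10 * a₀} ≃
          ↥{p : E3 | p ∈ hcpStacking a₀ h₀ ∧ p ≠ 0 ∧ ‖p‖ < 13 / 10 * a₀},
        ∀ t : ↥{z : E3 | z ∈ Set.range (Blocks.blockConfig P K) ∧ z ≠ Blocks.blockConfig P K a ∧
            dist z (Blocks.blockConfig P K a) < 13 / 10 * a₀},
          dist ((t : E3) - Blocks.blockConfig P K a)
            (A ((e t : ↥{p : E3 | p ∈ hcpStacking a₀ h₀ ∧ p ≠ 0 ∧ ‖p‖ < 13 / 10 * a₀}) : E3)) ≤ τ) ∨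
      (∃ e : ↥{z : E3 | z ∈ Set.range (Blocks.blockConfig P K) ∧ z ≠ Blocks.blockConfig P K a ∧
            dist z (Blocks.blockConfig P K a) < 13 / 10 * a₀} ≃
          ↥{p : E3 | p ∈ fccStacking a₀ h₀ ∧ p ≠ 0 ∧ ‖p‖ < 13 / 10 * a₀},
        ∀ t : ↥{z : E3 | z ∈ Set.range (Blocks.blockConfig P K) ∧ z ≠ Blocks.blockConfig P K a ∧
            dist z (Blocks.blockConfig P K a) < 13 / 10 * a₀},
          dist ((t : E3) - Blocks.blockConfig P K a)
            (A ((e t : ↥{p : E3 | p ∈ fccStacking a₀ h₀ ∧ p ≠ 0 ∧ ‖p‖ < 13 / 10 * a₀}) : E3)) ≤ τ)) →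
    ∃ A : E3 →ₗᵢ[ℝ] E3,
      (∃ e : ↥{z : E3 | z ∈ P.points ∧
            z ≠ ((((Fintype.equivFin (Blocks.BIdx P K)).symm a).1 : E3)) ∧
            dist z ((((Fintype.equivFin (Blocks.BIdx P K)).symm a).1 : E3)) < 13 / 10 * a₀} ≃
          ↥{p : E3 | p ∈ hcpStacking a₀ h₀ ∧ p ≠ 0 ∧ ‖p‖ < 13 / 10 * a₀},
        ∀ t : ↥{z : E3 | z ∈ P.points ∧
            z ≠ ((((Fintype.equivFin (Blocks.BIdx P K)).symm a).1 : E3)) ∧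
            dist z ((((Fintype.equivFin (Blocks.BIdx P K)).symm a).1 : E3)) < 13 / 10 * a₀},
          dist ((t : E3) - ((((Fintype.equivFin (Blocks.BIdx P K)).symm a).1 : E3)))
            (A ((e t : ↥{p : E3 | p ∈ hcpStacking a₀ h₀ ∧ p ≠ 0 ∧ ‖p‖ < 13 / 10 * a₀}) : E3)) ≤ τ) ∨
      (∃ e : ↥{z : E3 | z ∈ P.points ∧
            z ≠ ((((Fintype.equivFin (Blocks.BIdx P K)).symm a).1 : E3)) ∧
            dist z ((((Fintype.equivFin (Blocks.BIdx P K)).symm a).1 : E3)) < 13 / 10 * a₀} ≃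
          ↥{p : E3 | p ∈ fccStacking a₀ h₀ ∧ p ≠ 0 ∧ ‖p‖ < 13 / 10 * a₀},
        ∀ t : ↥{z : E3 | z ∈ P.points ∧
            z ≠ ((((Fintype.equivFin (Blocks.BIdx P K)).symm a).1 : E3)) ∧
            dist z ((((Fintype.equivFin (Blocks.BIdx P K)).symm a).1 : E3)) < 13 / 10 * a₀},
          dist ((t : E3) - ((((Fintype.equivFin (Blocks.BIdx P K)).symm a).1 : E3)))
            (A ((e t : ↥{p : E3 | p ∈ fccStacking a₀ h₀ ∧ p ≠ 0 ∧ ‖p‖ < 13 / 10 * a₀}) : E3)) ≤ τ) := by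
  intro h
  have hr : 13 / 10 * a₀ ≤ 2 := by linarith
  rw [shell_block_eq P K hr hdeep] at h
  have hxa : Blocks.blockConfig P K a = ((((Fintype.equivFin (Blocks.BIdx P K)).symm a).1 : E3)) +
      Blocks.latVec P (Blocks.coords K ((Fintype.equivFin (Blocks.BIdx P K)).symm a).2) := rfl
  rw [hxa] at h
  exact good_of_good_add P (Blocks.latVec_mem P _) h

/-! ## The registered stub -/

/-- **Registered sub-goal `stub_blocksConverse` (L; not part of the composition): finite `1/3`-separated
K1 ⇒ torus K1** (same cell, same `κ(τ)`).  Trial blocks of a `1/3`-separated periodic `P`: the finite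
configurations `x_K = Blocks.blockConfig P K` (`K³` cells) have `E(x_K) ≤ K³·#motif·e(P) + c_P·K²`
(`ChargedEnergyGap.Negative.BlocksBound/BlocksEnergy/BlocksTails`), and a `depth 2`-deep block point is
τ-bad in `x_K` iff its motif class is τ-bad in `P.points` (its open `13/10·a₀ ≤ 13/10 < 2`-shell is read
inside the block; statuses are invariant under the periods), so `#bad(x_K) ≥ #bad motif·(K³ − 12K²)`;
feed `B := bad(x_K)` to the hypothesis, divide by `K³` and let `K → ∞`
(port of `CoerciveTwoShellGapBlocks.torusTwoShellGap_of_sepTwoShellGap`).  With stubs 3–4 it records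
that K1 IS its torus form. [folklore] -/
theorem stub_blocksConverse :
    (∃ a₀ h₀ : ℝ, 47 / 50 ≤ a₀ ∧ a₀ ≤ 1 ∧ |h₀ - a₀ * Real.sqrt (2 / 3)| ≤ a₀ / 100 ∧
       ∀ τ : ℝ, 0 < τ → τ ≤ 1 → ∃ κ : ℝ, 0 < κ ∧
         ∀ (N : ℕ) (y : Fin N → EuclideanSpace ℝ (Fin 3)), (∀ i j : Fin N, i ≠ j → (1 / 3 : ℝ) ≤ dist (y i) (y j)) →
           ∀ B : Finset (Fin N), (∀ i ∈ B,
             ¬ (∃ A : EuclideanSpace ℝ (Fin 3) →ₗᵢ[ℝ] EuclideanSpace ℝ (Fin 3),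
                 (∃ e : ↥{z : EuclideanSpace ℝ (Fin 3) | z ∈ Set.range y ∧ z ≠ y i ∧ dist z (y i) < 13 / 10 * a₀} ≃
                     ↥{p : EuclideanSpace ℝ (Fin 3) | p ∈ hcpStacking a₀ h₀ ∧ p ≠ 0 ∧ ‖p‖ < 13 / 10 * a₀},
                   ∀ t : ↥{z : EuclideanSpace ℝ (Fin 3) | z ∈ Set.range y ∧ z ≠ y i ∧ dist z (y i) < 13 / 10 * a₀},
                     dist ((t : EuclideanSpace ℝ (Fin 3)) - y i)
                       (A ((e t : ↥{p : EuclideanSpace ℝ (Fin 3) | p ∈ hcpStacking a₀ h₀ ∧ p ≠ 0 ∧ ‖p‖ < 13 / 10 * a₀}) : EuclideanSpace ℝ (Fin 3))) ≤ τ) ∨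
                 (∃ e : ↥{z : EuclideanSpace ℝ (Fin 3) | z ∈ Set.range y ∧ z ≠ y i ∧ dist z (y i) < 13 / 10 * a₀} ≃
                     ↥{p : EuclideanSpace ℝ (Fin 3) | p ∈ fccStacking a₀ h₀ ∧ p ≠ 0 ∧ ‖p‖ < 13 / 10 * a₀},
                   ∀ t : ↥{z : EuclideanSpace ℝ (Fin 3) | z ∈ Set.range y ∧ z ≠ y i ∧ dist z (y i) < 13 / 10 * a₀},
                     dist ((t : EuclideanSpace ℝ (Fin 3)) - y i)
                       (A ((e t : ↥{p : EuclideanSpace ℝ (Fin 3) | p ∈ fccStacking a₀ h₀ ∧ p ≠ 0 ∧ ‖p‖ < 13 / 10 * a₀}) : EuclideanSpace ℝ (Fin 3))) ≤ τ))) →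
           κ * (B.card : ℝ) ≤ interactionEnergy lennardJones y - (N : ℝ) * (⨅ Q : PeriodicConfiguration 3, Q.energyPerParticle lennardJones)) →
    ∃ a₀ h₀ : ℝ, 47 / 50 ≤ a₀ ∧ a₀ ≤ 1 ∧ |h₀ - a₀ * Real.sqrt (2 / 3)| ≤ a₀ / 100 ∧
      ∀ τ : ℝ, 0 < τ → τ ≤ 1 → ∃ κ : ℝ, 0 < κ ∧
        ∀ P : PeriodicConfiguration 3, (∀ u ∈ P.points, ∀ v ∈ P.points, u ≠ v → (1 / 3 : ℝ) ≤ dist u v) →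
          κ * ((P.motif.filter fun q =>
              ¬ (∃ A : EuclideanSpace ℝ (Fin 3) →ₗᵢ[ℝ] EuclideanSpace ℝ (Fin 3),
                  (∃ e : ↥{z : EuclideanSpace ℝ (Fin 3) | z ∈ P.points ∧ z ≠ q ∧ dist z (q) < 13 / 10 * a₀} ≃
                      ↥{p : EuclideanSpace ℝ (Fin 3) | p ∈ hcpStacking a₀ h₀ ∧ p ≠ 0 ∧ ‖p‖ < 13 / 10 * a₀},
                    ∀ t : ↥{z : EuclideanSpace ℝ (Fin 3) | z ∈ P.points ∧ z ≠ q ∧ dist z (q) < 13 / 10 * a₀},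
                      dist ((t : EuclideanSpace ℝ (Fin 3)) - q)
                        (A ((e t : ↥{p : EuclideanSpace ℝ (Fin 3) | p ∈ hcpStacking a₀ h₀ ∧ p ≠ 0 ∧ ‖p‖ < 13 / 10 * a₀}) : EuclideanSpace ℝ (Fin 3))) ≤ τ) ∨
                  (∃ e : ↥{z : EuclideanSpace ℝ (Fin 3) | z ∈ P.points ∧ z ≠ q ∧ dist z (q) < 13 / 10 * a₀} ≃
                      ↥{p : EuclideanSpace ℝ (Fin 3) | p ∈ fccStacking a₀ h₀ ∧ p ≠ 0 ∧ ‖p‖ < 13 / 10 * a₀},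
                    ∀ t : ↥{z : EuclideanSpace ℝ (Fin 3) | z ∈ P.points ∧ z ≠ q ∧ dist z (q) < 13 / 10 * a₀},
                      dist ((t : EuclideanSpace ℝ (Fin 3)) - q)
                        (A ((e t : ↥{p : EuclideanSpace ℝ (Fin 3) | p ∈ fccStacking a₀ h₀ ∧ p ≠ 0 ∧ ‖p‖ < 13 / 10 * a₀}) : EuclideanSpace ℝ (Fin 3))) ≤ τ))).card : ℝ)
          ≤ (P.motif.card : ℝ) * (P.energyPerParticle lennardJones - (⨅ Q : PeriodicConfiguration 3, Q.energyPerParticle lennardJones)) := by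
  rintro ⟨a₀, h₀, ha1, ha2, hh, H⟩
  refine ⟨a₀, h₀, ha1, ha2, hh, fun τ hτ hτ1 => ?_⟩
  obtain ⟨κ, hκ, hK⟩ := H τ hτ hτ1
  refine ⟨κ, hκ, fun P hsep => ?_⟩
  exact torus_of_blocks P hκ (fun K a hd => good_transfer P K ha2 hd)
    (fun K => hK _ (Blocks.blockConfig P K) (CoerciveTwoShellGapBlocks.block_separated P K hsep))

end Summit.AtomisticToContinuum.Crystallization.Theorems.SummedShellPricingBlocks

end
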